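import Summits.ResolutionOfSingularities.ResolutionOfSingularities.Theorems.EquisingularLiftEquisingularLiftNatResidueHypDefsE2
import HarnessLib

/-!
# [OURS · L1 W4.5(b) · EL♮ / EL♮(3)] RESIDUE HYPOTHESIS DEFS E4 — WIDTH TABLE D9 door ν3ᵈ «DIRECT PLANAR NOSE»: `ReachDirectPlanarNose₂` and the blob
# `NoseHypHostedNestEquinodalDirectBTriplePrime₂` (= …DefsE2's blob₃ᵉ v2 with the initial-stage planar-nose rule's door widened to «EQUINODAL ∨ DIRECT»)

Typed by res-type-027 g23 on the desk's RULING R71 (ii) (2026-08-29T06:07Z; D9 «ν3-DIRECT» DEALT on the panel-certified customer S_ν(G₇) = V(g₇² + w²B♮₁₄) ⊂ ℙ³/𝔽̄₇,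
lead-1 `SNU-G7-CERTIFICATE.md` f2094ef1643d0b39, worked twin S_ν(G₅); idea-2's NU7-NOSE-SIZING v1.2 b47125f3e794221e §A1–§A3 / §0⁺ checklist d1–d6; module
name per idea-2's catch 06:09:58Z — `…DefsE3` is nose-w1's RPlus file).  WHAT.  (a) `ReachDirectPlanarNose₂ k n ℓ T₁ F₉ β T₉ E₉` — door ν3ᵈ: ν4's door
`ReachEquinodalPlanarNose₂` (…DefsE2) with (d1) the certificate `EqCertAt₀` REPLACED by its clauses 1–4 only (the EQUATION block: `g` homogeneous of degree
`e`, `Squarefree (restrictToHyperplane B g)`, `Z = V₊(ℓ) ∩ V₊(g)` as a set, `restrictToHyperplane B ℓ = 0`, `r` injective with invertible minor — NO marked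
nodes, NO (CERT-EQ)), (d2) the inner sub-chain motive DELETED (`F₂ := ℙⁿ`, `υ := 𝟙`, `Z₂ := Z`: the nose round happens AT `Z` ITSELF), (d3) the clause «`Z̃₂`
regular» REPLACED by (N1) «the non-regular locus of `Z̃` is finite», host-regular-along-`Z̃` and the curve clause kept, (d4) the nose blow-up + B‴ tail ∀-clause
verbatim (at `Z`), (d5) the n-scope clauses verbatim — the text is res-L1-w45b-stub-4 g14's by-type stand-in `rungd/StandInDoorD.lean` 04b6cf853668634c
VERBATIM (so its HSUBᵈ `Direct.hsubd_of_smoothing` 3693f4d9406fe6ed re-points with no edit); the upstairs supplier of the round is res-L1-w45b-stub-2's Σ1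
SMOOTHING LEMMA `planar_trace_smoothing` (SIG e3c9ce86dd96b53d; parts ✓ p701505 …): the centre `𝒞 = V(ℓ̃, g̃ + ϖU) ⊂ ℙ³_O` is regular, `O`-flat, with reduced
trace `Z`.  (b) `NoseHypHostedNestEquinodalDirectBTriplePrime₂ k n H ι` — …DefsE2's `NoseHypHostedNestEquinodalBTriplePrime₂` VERBATIM except that the
initial-stage planar-nose rule's hypothesis `ReachEquinodalPlanarNose₂ …` becomes the DISJUNCTION `(ReachEquinodalPlanarNose₂ … ∨ ReachDirectPlanarNose₂ …)`
(d6: the «∨» sits exactly where ν4's door sits — ONE closure rule with a disjunctive door, so the engine K5ᵉᵈ is ✓ K5ᵉ with `HSUB := hR.elim HSUBᵉ HSUBᵈ`,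
stub-4's (δ)/(ζ)).  (c) PURE LOGIC: `noseHypHostedNestEquinodalDirectBTriplePrime₂_of_equinodal₂` (blob₃ᵉ v2 ⇒ new blob: more closure asked of `Q` is implied,
`Or.inl`), the contrapositive `not_noseHypHostedNestEquinodalBTriplePrime₂_of_not_equinodalDirect₂` (what the 46th REPLACE «ν4 ↦ ν4 ∨ ν3ᵈ» consumes), and the
chained `not_` lemmas down to `NoseHypPointsFirstBTriplePrime`.  (d) «EQUINODAL ⊆ DIRECT on planar members» is NOT an implication between the two door TEXTS
(different sub-chain / end data) — not typed.  Rung shape (R-ν3ᵈ, stub-4 `nose_direct_rung_three` over K5ᵉᵈ): the registered nose residue's binders with last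
hypothesis THIS blob ⊢ `ELNatConclusionO k n H ι`; the 46th = REPLACE `¬ …Equinodal…₂ ↦ ¬ …EquinodalDirect…₂`, old residue DERIVED by `by_cases`, count-neutral.
n-SCOPE: as ν4 (host-dimension and curve clauses make the rule fire only for n = 3).  HONEST SIZING (NU7 v1.2): after the 46th the nose residue is
«¬(EQUINODAL ∨ DIRECT-planar)»; Σ2/Σ3/Σ5/Σ6/Σ7 and every non-planar nose remain outside by letters.
House style R21″ (C): definitions + pure-logic lemmas; no `sorry`, no instance, no notation; standard axioms.  OURS; NAMED HYPOTHESES, not statements of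
any manuscript; nothing of [Hironaka2017] is asserted; AI-written, weaker than expert review; EL♮(3) NOT proved; resolution in positive characteristic NOT
proved (dim 3 = Cossart–Piltant 2008/2009).  `--kind definition --supports stmt-ResolutionOfSingularities-20148 --as helper`.
-/

set_option linter.dupNamespace false
noncomputable section
open CategoryTheory CategoryTheory.Limits AlgebraicGeometry TopologicalSpace Topology IsLocalRing
open Literature.AlgebraicGeometry.Resolution
open AlgebraicGeometry.Scheme.IdealSheafData
namespace Summit.ResolutionOfSingularities.ResolutionOfSingularities.Cruxes.EquisingularLiftNat.Sections

/-- **`ReachDirectPlanarNose₂ k n ℓ T₁ F₉ β T₉ E₉`** — door ν3ᵈ «DIRECT PLANAR NOSE» (WIDTH TABLE D9, desk R71), INITIAL STAGE, host the hyperplane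
`Π = V₊(ℓ)` of `ℙⁿ_k`; same currency as `ReachEquinodalPlanarNose₂` (…DefsE2) and `ReachHostedNoseBTriplePrime` (…Defs6): the reached stage is
`(F₉, β : F₉ ⟶ ℙⁿ, T₉, E₉)` with the host dropped (`E₉ = ∅`).  Text = ν4's door with the certificate `EqCertAt₀` cut back to its EQUATION block (one
squarefree form `g` of degree `e` cutting out `Z` on `Π`, hyperplane coordinates `B`, an invertible minor `r` — NO marked nodes, NO (CERT-EQ)), the inner
sub-chain motive DELETED (the nose round is AT `Z` ITSELF: `F₂ := ℙⁿ`, `υ := 𝟙`, `Z₂ := Z`), «`Z̃₂` regular» REPLACED by (N1) «finitely many non-regular points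
of `Z̃`», host-regular-along-`Z̃` / curve / host-dimension clauses kept, then the nose blow-up at `Z` and a B‴ tail verbatim.  Upstairs supplier: the explicit
planar SMOOTHING `V(ℓ̃, g̃ + ϖU)` of the reduced trace (stub-2's `planar_trace_smoothing`) + ✓ `hsube_of_suppliers`' PHASE 2 (stub-4's HSUBᵈ).  (= stub-4 g14's
by-type stand-in `rungd/StandInDoorD.lean` 04b6cf853668634c VERBATIM.)  [OURS · named hypothesis fragment, no mathematical content of its own] -/
def ReachDirectPlanarNose₂ (k : Type) [Field k] (n : ℕ) (ℓ : MvPolynomial (Fin (n + 1)) k)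
    (T₁ : Set (Literature.AlgebraicGeometry.Motives.projectiveSpace n k).left) (F₉ : Scheme.{0}) (β : F₉ ⟶ (Literature.AlgebraicGeometry.Motives.projectiveSpace n k).left) (T₉ E₉ : Set F₉) : Prop :=
  letI := MvPolynomial.gradedAlgebra (σ := Fin (n + 1)) (R := k)
  E₉ = ∅ ∧
  ∃ (Z : Set (Literature.AlgebraicGeometry.Motives.projectiveSpace n k).left) (hZ : IsClosed Z),
    Z ⊆ T₁ ∧ ¬ (T₁ ⊆ Z) ∧ Z.Infinite ∧
    Z ⊆ {y : (Literature.AlgebraicGeometry.Motives.projectiveSpace n k).left | ℓ ∈ (y : ProjectiveSpectrum (MvPolynomial.homogeneousSubmodule (Fin (n + 1)) k)).asHomogeneousIdeal} ∧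
    IsPreirreducible Z ∧
    -- curve clause
    (∀ z : ↥(redSub (Literature.AlgebraicGeometry.Motives.projectiveSpace n k).left Z hZ), IsClosed ({z} : Set ↥(redSub (Literature.AlgebraicGeometry.Motives.projectiveSpace n k).left Z hZ)) →
      ringKrullDim ((redSub (Literature.AlgebraicGeometry.Motives.projectiveSpace n k).left Z hZ).presheaf.stalk z) = ((1 : ℕ) : WithBot ℕ∞)) ∧
    -- ambient regular along `Z̃`
    (∀ (i : redSub (Literature.AlgebraicGeometry.Motives.projectiveSpace n k).left Z hZ ⟶ redSub (Literature.AlgebraicGeometry.Motives.projectiveSpace n k).left Set.univ isClosed_univ), i ≫ redSubι (Literature.AlgebraicGeometry.Motives.projectiveSpace n k).left Set.univ isClosed_univ = redSubι (Literature.AlgebraicGeometry.Motives.projectiveSpace n k).left Z hZ →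
      ∀ z : ↥(redSub (Literature.AlgebraicGeometry.Motives.projectiveSpace n k).left Z hZ), IsRegularLocalRing ((redSub (Literature.AlgebraicGeometry.Motives.projectiveSpace n k).left Set.univ isClosed_univ).presheaf.stalk (i.base z))) ∧
    -- host regular along `Z̃`
    (∀ (i : redSub (Literature.AlgebraicGeometry.Motives.projectiveSpace n k).left Z hZ ⟶ redSub (Literature.AlgebraicGeometry.Motives.projectiveSpace n k).left (closure {y : (Literature.AlgebraicGeometry.Motives.projectiveSpace n k).left | ℓ ∈ (y : ProjectiveSpectrum (MvPolynomial.homogeneousSubmodule (Fin (n + 1)) k)).asHomogeneousIdeal}) isClosed_closure),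
      i ≫ redSubι (Literature.AlgebraicGeometry.Motives.projectiveSpace n k).left (closure {y : (Literature.AlgebraicGeometry.Motives.projectiveSpace n k).left | ℓ ∈ (y : ProjectiveSpectrum (MvPolynomial.homogeneousSubmodule (Fin (n + 1)) k)).asHomogeneousIdeal}) isClosed_closure = redSubι (Literature.AlgebraicGeometry.Motives.projectiveSpace n k).left Z hZ →
      ∀ z : ↥(redSub (Literature.AlgebraicGeometry.Motives.projectiveSpace n k).left Z hZ), IsRegularLocalRing ((redSub (Literature.AlgebraicGeometry.Motives.projectiveSpace n k).left (closure {y : (Literature.AlgebraicGeometry.Motives.projectiveSpace n k).left | ℓ ∈ (y : ProjectiveSpectrum (MvPolynomial.homogeneousSubmodule (Fin (n + 1)) k)).asHomogeneousIdeal}) isClosed_closure).presheaf.stalk (i.base z))) ∧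
    -- host two-dimensional along `Z` (n = 3 in effect)
    (∀ e : ↥(redSub (Literature.AlgebraicGeometry.Motives.projectiveSpace n k).left (closure {y : (Literature.AlgebraicGeometry.Motives.projectiveSpace n k).left | ℓ ∈ (y : ProjectiveSpectrum (MvPolynomial.homogeneousSubmodule (Fin (n + 1)) k)).asHomogeneousIdeal}) isClosed_closure),
      IsClosed ({e} : Set ↥(redSub (Literature.AlgebraicGeometry.Motives.projectiveSpace n k).left (closure {y : (Literature.AlgebraicGeometry.Motives.projectiveSpace n k).left | ℓ ∈ (y : ProjectiveSpectrum (MvPolynomial.homogeneousSubmodule (Fin (n + 1)) k)).asHomogeneousIdeal}) isClosed_closure)) →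
      (redSubι (Literature.AlgebraicGeometry.Motives.projectiveSpace n k).left (closure {y : (Literature.AlgebraicGeometry.Motives.projectiveSpace n k).left | ℓ ∈ (y : ProjectiveSpectrum (MvPolynomial.homogeneousSubmodule (Fin (n + 1)) k)).asHomogeneousIdeal}) isClosed_closure e : (Literature.AlgebraicGeometry.Motives.projectiveSpace n k).left) ∈ Z →
      ringKrullDim ((redSub (Literature.AlgebraicGeometry.Motives.projectiveSpace n k).left (closure {y : (Literature.AlgebraicGeometry.Motives.projectiveSpace n k).left | ℓ ∈ (y : ProjectiveSpectrum (MvPolynomial.homogeneousSubmodule (Fin (n + 1)) k)).asHomogeneousIdeal}) isClosed_closure).presheaf.stalk e) = ((2 : ℕ) : WithBot ℕ∞)) ∧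
    -- (N1) finitely many non-regular points of the reduced nose `Z̃` (requested binder; = stub-2's SIG binder verbatim)
    Set.Finite {z : ↥(redSub (Literature.AlgebraicGeometry.Motives.projectiveSpace n k).left Z hZ) |
      ¬ IsRegularLocalRing ((redSub (Literature.AlgebraicGeometry.Motives.projectiveSpace n k).left Z hZ).presheaf.stalk z)} ∧
    -- the EQUATION block (= `EqCertAt₀`'s clauses 1–4: hyperplane coordinates `B` and ONE squarefree form `g` cutting out `Z` on `V₊(ℓ)`)
    (∃ (e : ℕ) (g : MvPolynomial (Fin (n + 1)) k) (B : Fin (n + 1) → Fin n → k) (r : Fin n → Fin (n + 1)),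
      g.IsHomogeneous e ∧ Squarefree (restrictToHyperplane B g) ∧
      Z = {y : (Literature.AlgebraicGeometry.Motives.projectiveSpace n k).left | ℓ ∈ (y : ProjectiveSpectrum (MvPolynomial.homogeneousSubmodule (Fin (n + 1)) k)).asHomogeneousIdeal ∧
             g ∈ (y : ProjectiveSpectrum (MvPolynomial.homogeneousSubmodule (Fin (n + 1)) k)).asHomogeneousIdeal} ∧
      restrictToHyperplane B ℓ = 0 ∧ Function.Injective r ∧ (Matrix.of fun j j' : Fin n => B (r j) j').det ≠ 0) ∧
    -- the DIRECT nose round at `Z` itself (no inner motive, no reached-stage clauses), then a B‴ tail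
    ∃ (F₃ : Scheme.{0}) (υ' : F₃ ⟶ (Literature.AlgebraicGeometry.Motives.projectiveSpace n k).left),
      IsBlowup υ' (vanishingIdeal (⟨Z, hZ⟩ : Closeds (Literature.AlgebraicGeometry.Motives.projectiveSpace n k).left)) ∧
      ∃ (γ' : F₉ ⟶ F₃) (E' : Set F₉) (Es' Ns' : List (Set F₉)) (K' : Set F₉),
        (∀ R : (∀ G : Scheme.{0}, (G ⟶ F₃) → Set G → Set G → List (Set G) → List (Set G) → Set G → Prop),
          R F₃ (𝟙 F₃) (closure (υ' ⁻¹' (T₁ \ Z))) (υ' ⁻¹' Z) [] [] ∅ →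
          TowerPtRegB₄ F₃ R → TowerPtRamB₄ F₃ R → TowerRoundBTriplePrime (Literature.AlgebraicGeometry.Motives.projectiveSpace n k).left F₃ υ' Z hZ R →
          R F₉ γ' T₉ E' Es' Ns' K') ∧
        β = γ' ≫ υ'

/-- **`NoseHypHostedNestEquinodalDirectBTriplePrime₂ k n H ι`** (blob for the 46th, door «ν4 ∨ ν3ᵈ») — `NoseHypHostedNestEquinodalBTriplePrime₂` (…DefsE2)
VERBATIM (the `E₀` binder, the point-step clause, the stage-level hosted-round clause, the `ReachHostedNoseBTriplePrime` clause, the regular end), except that the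
initial-stage planar-nose rule now transports `Q` from `(ℙⁿ, 𝟙, range ι, E₀ = V₊(ℓ))` to `(F₉, β, T₉, E₉)` along EITHER door: its hypothesis is the disjunction
`ReachEquinodalPlanarNose₂ … ∨ ReachDirectPlanarNose₂ …` (placement = where ν4's door sits; engine K5ᵉᵈ = K5ᵉ with `HSUB := hR.elim HSUBᵉ HSUBᵈ`).  More closure
asked of `Q` ⇒ implied by blob₃ᵉ v2 (`…_of_equinodal₂` below, pure logic).  Rung shape (R-ν3ᵈ, stub-4): the registered nose residue's binders with last hypothesis
THIS blob ⊢ `ELNatConclusionO k n H ι`; the 46th = REPLACE `¬ NoseHypHostedNestEquinodalBTriplePrime₂ ↦ ¬ NoseHypHostedNestEquinodalDirectBTriplePrime₂`.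
[OURS · L1 W4.5b · named hypothesis, no mathematical content of its own] -/
def NoseHypHostedNestEquinodalDirectBTriplePrime₂ (k : Type) [Field k] [IsAlgClosed k] (n : ℕ) (H : AlgebraicGeometry.Scheme.{0})
    (ι : H ⟶ (Literature.AlgebraicGeometry.Motives.projectiveSpace n k).left) : Prop :=
  letI := MvPolynomial.gradedAlgebra (σ := Fin (n + 1)) (R := k)
  ∃ (E₀ : Set (Literature.AlgebraicGeometry.Motives.projectiveSpace n k).left),
    (E₀ = ∅ ∨ ∃ ℓ : MvPolynomial (Fin (n + 1)) k, ℓ.IsHomogeneous 1 ∧ ℓ ≠ 0 ∧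
      ¬ (Set.range ι ⊆ {y : (Literature.AlgebraicGeometry.Motives.projectiveSpace n k).left |
        ℓ ∈ (y : ProjectiveSpectrum (MvPolynomial.homogeneousSubmodule (Fin (n + 1)) k)).asHomogeneousIdeal}) ∧
      E₀ = {y : (Literature.AlgebraicGeometry.Motives.projectiveSpace n k).left |
        ℓ ∈ (y : ProjectiveSpectrum (MvPolynomial.homogeneousSubmodule (Fin (n + 1)) k)).asHomogeneousIdeal}) ∧
    (∃ (F' : AlgebraicGeometry.Scheme.{0}) (ρ' : F' ⟶ (Literature.AlgebraicGeometry.Motives.projectiveSpace n k).left) (T' : Set F'),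
      (∀ Q : (∀ F₁ : AlgebraicGeometry.Scheme.{0}, (F₁ ⟶ (Literature.AlgebraicGeometry.Motives.projectiveSpace n k).left) → Set F₁ → Set F₁ → Prop),
        Q (Literature.AlgebraicGeometry.Motives.projectiveSpace n k).left (𝟙 (Literature.AlgebraicGeometry.Motives.projectiveSpace n k).left) (Set.range ι) E₀ →
        (∀ (F₁ F₂ : AlgebraicGeometry.Scheme.{0}) (ρ : F₁ ⟶ (Literature.AlgebraicGeometry.Motives.projectiveSpace n k).left) (T₁ E₁ : Set F₁)
            (x : ↥((AlgebraicGeometry.Scheme.IdealSheafData.vanishingIdeal (⟨closure T₁, isClosed_closure⟩ : TopologicalSpace.Closeds F₁))).subscheme) (υ : F₂ ⟶ F₁) (hx : IsClosed ({(((AlgebraicGeometry.Scheme.IdealSheafData.vanishingIdeal (⟨closure T₁, isClosed_closure⟩ : TopologicalSpace.Closeds F₁))).subschemeι x : F₁)} : Set F₁)),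
          Q F₁ ρ T₁ E₁ → ¬ IsRegularLocalRing (((AlgebraicGeometry.Scheme.IdealSheafData.vanishingIdeal (⟨closure T₁, isClosed_closure⟩ : TopologicalSpace.Closeds F₁))).subscheme.presheaf.stalk x) →
          IsRegularLocalRing (F₁.presheaf.stalk (((AlgebraicGeometry.Scheme.IdealSheafData.vanishingIdeal (⟨closure T₁, isClosed_closure⟩ : TopologicalSpace.Closeds F₁))).subschemeι x : F₁)) →
          ((((AlgebraicGeometry.Scheme.IdealSheafData.vanishingIdeal (⟨closure T₁, isClosed_closure⟩ : TopologicalSpace.Closeds F₁))).subschemeι x : F₁) ∈ closure E₁ → ∀ e : ↥(redSub F₁ (closure E₁) isClosed_closure), (redSubι F₁ (closure E₁) isClosed_closure e : F₁) = (((AlgebraicGeometry.Scheme.IdealSheafData.vanishingIdeal (⟨closure T₁, isClosed_closure⟩ : TopologicalSpace.Closeds F₁))).subschemeι x : F₁) →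
          IsRegularLocalRing ((redSub F₁ (closure E₁) isClosed_closure).presheaf.stalk e)) → Literature.AlgebraicGeometry.Resolution.IsBlowup υ
            (AlgebraicGeometry.Scheme.IdealSheafData.vanishingIdeal (⟨{(((AlgebraicGeometry.Scheme.IdealSheafData.vanishingIdeal (⟨closure T₁, isClosed_closure⟩ : TopologicalSpace.Closeds F₁))).subschemeι x : F₁)}, hx⟩ : TopologicalSpace.Closeds F₁)) →
          Q F₂ (υ ≫ ρ) (closure (υ ⁻¹' (T₁ \ {(((AlgebraicGeometry.Scheme.IdealSheafData.vanishingIdeal (⟨closure T₁, isClosed_closure⟩ : TopologicalSpace.Closeds F₁))).subschemeι x : F₁)}))) (closure (υ ⁻¹' (E₁ \ {(((AlgebraicGeometry.Scheme.IdealSheafData.vanishingIdeal (⟨closure T₁, isClosed_closure⟩ : TopologicalSpace.Closeds F₁))).subschemeι x : F₁)})))) →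
        -- STAGE-LEVEL HOSTED ROUND at a regular curve `Z` inside the host, unobstructed IN THE HOST (in-host NEST lines and the nose curve alike)
        (∀ (F₁ F₃ : AlgebraicGeometry.Scheme.{0}) (ρ : F₁ ⟶ (Literature.AlgebraicGeometry.Motives.projectiveSpace n k).left) (T₁ E₁ : Set F₁) (Z : Set F₁) (hZ : IsClosed Z) (υ' : F₃ ⟶ F₁),
          Q F₁ ρ T₁ E₁ → Z ⊆ closure E₁ → Z ⊆ T₁ → ¬ T₁ ⊆ Z → (∀ z : ↥(redSub F₁ Z hZ), IsRegularLocalRing ((redSub F₁ Z hZ).presheaf.stalk z)) →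
          (∀ (i : redSub F₁ Z hZ ⟶ redSub F₁ (closure E₁) isClosed_closure), i ≫ redSubι F₁ (closure E₁) isClosed_closure = redSubι F₁ Z hZ →
            ∀ z : ↥(redSub F₁ Z hZ), IsRegularLocalRing ((redSub F₁ (closure E₁) isClosed_closure).presheaf.stalk (i z))) → DirStepUnobs F₁ (closure E₁) isClosed_closure Z hZ →
          (∀ z : ↥(redSub F₁ Z hZ), IsClosed ({z} : Set ↥(redSub F₁ Z hZ)) → ringKrullDim ((redSub F₁ Z hZ).presheaf.stalk z) = ((1 : ℕ) : WithBot ℕ∞)) →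
          Literature.AlgebraicGeometry.Resolution.IsBlowup υ' (AlgebraicGeometry.Scheme.IdealSheafData.vanishingIdeal (⟨Z, hZ⟩ : TopologicalSpace.Closeds F₁)) →
          Q F₃ (υ' ≫ ρ) (closure (υ' ⁻¹' (T₁ \ Z))) (closure (υ' ⁻¹' (closure E₁ \ Z)))) →
        (∀ (F₁ : AlgebraicGeometry.Scheme.{0}) (ρ : F₁ ⟶ (Literature.AlgebraicGeometry.Motives.projectiveSpace n k).left) (T₁ E₁ : Set F₁) (F₉ : AlgebraicGeometry.Scheme.{0}) (β : F₉ ⟶ F₁) (T₉ E₉ : Set F₉),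
          Q F₁ ρ T₁ E₁ → ReachHostedNoseBTriplePrime F₁ T₁ E₁ F₉ β T₉ E₉ → Q F₉ (β ≫ ρ) T₉ E₉) →
        -- INITIAL-STAGE PLANAR NOSE inside the hyperplane host `E₀ = V₊(ℓ)`: EITHER door ν4 «EQUINODAL» (`ReachEquinodalPlanarNose₂`: the sub-chain
        -- blows up the marked nodes, rounds the in-host lines, then the nose round on the transform and a B‴ tail) OR door ν3ᵈ «DIRECT» (`ReachDirectPlanarNose₂`:
        -- the nose round at `Z` itself — upstairs centre = an explicit planar SMOOTHING of the reduced trace —, then a B‴ tail); unavailable when `E₀ = ∅`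
        (∀ (ℓ : MvPolynomial (Fin (n + 1)) k) (F₉ : AlgebraicGeometry.Scheme.{0}) (β : F₉ ⟶ (Literature.AlgebraicGeometry.Motives.projectiveSpace n k).left) (T₉ E₉ : Set F₉),
          Q (Literature.AlgebraicGeometry.Motives.projectiveSpace n k).left (𝟙 (Literature.AlgebraicGeometry.Motives.projectiveSpace n k).left) (Set.range ι) E₀ →
          E₀ = {y : (Literature.AlgebraicGeometry.Motives.projectiveSpace n k).left |
            ℓ ∈ (y : ProjectiveSpectrum (MvPolynomial.homogeneousSubmodule (Fin (n + 1)) k)).asHomogeneousIdeal} →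
          (ReachEquinodalPlanarNose₂ k n ℓ (Set.range ι) F₉ β T₉ E₉ ∨ ReachDirectPlanarNose₂ k n ℓ (Set.range ι) F₉ β T₉ E₉) →
            Q F₉ β T₉ E₉) → ∃ E' : Set F', Q F' ρ' T' E') ∧
      Literature.AlgebraicGeometry.Resolution.Scheme.IsRegular (AlgebraicGeometry.Scheme.IdealSheafData.vanishingIdeal (⟨closure T', isClosed_closure⟩ : TopologicalSpace.Closeds F')).subscheme)

/-- blob₃ᵉ v2 ⇒ the «ν4 ∨ ν3ᵈ» blob (the motive is asked to be closed under MORE moves; `Or.inl`). [OURS · pure logic] -/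
theorem noseHypHostedNestEquinodalDirectBTriplePrime₂_of_equinodal₂ (k : Type) [Field k] [IsAlgClosed k] (n : ℕ) (H : AlgebraicGeometry.Scheme.{0})
    (ι : H ⟶ (Literature.AlgebraicGeometry.Motives.projectiveSpace n k).left) (h : NoseHypHostedNestEquinodalBTriplePrime₂ k n H ι) :
    NoseHypHostedNestEquinodalDirectBTriplePrime₂ k n H ι := by
  obtain ⟨E₀, hE₀, F', ρ', T', hQ, hreg⟩ := h
  refine ⟨E₀, hE₀, F', ρ', T', fun Q hQ0 hpt hround hreach hdir => hQ Q hQ0 hpt hround hreach ?_, hreg⟩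
  intro ℓ F₉ β T₉ E₉ hQ₀ hE hR
  exact hdir ℓ F₉ β T₉ E₉ hQ₀ hE (Or.inl hR)

/-- blob₂ (`NoseHypHostedNestBTriplePrime₂`, …Defs7) ⇒ the «ν4 ∨ ν3ᵈ» blob. [OURS · pure logic] -/
theorem noseHypHostedNestEquinodalDirectBTriplePrime₂_of_hostedNest₂ (k : Type) [Field k] [IsAlgClosed k] (n : ℕ) (H : AlgebraicGeometry.Scheme.{0})
    (ι : H ⟶ (Literature.AlgebraicGeometry.Motives.projectiveSpace n k).left) (h : NoseHypHostedNestBTriplePrime₂ k n H ι) :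
    NoseHypHostedNestEquinodalDirectBTriplePrime₂ k n H ι :=
  noseHypHostedNestEquinodalDirectBTriplePrime₂_of_equinodal₂ k n H ι (noseHypHostedNestEquinodalBTriplePrime₂_of_hostedNest₂ k n H ι h)

/-- Contrapositive, as the 46th REPLACE cut consumes it: `¬ (ν4 ∨ ν3ᵈ blob) → ¬ blob₃ᵉ v2`. [OURS · pure logic] -/
theorem not_noseHypHostedNestEquinodalBTriplePrime₂_of_not_equinodalDirect₂ (k : Type) [Field k] [IsAlgClosed k] (n : ℕ)
    (H : AlgebraicGeometry.Scheme.{0}) (ι : H ⟶ (Literature.AlgebraicGeometry.Motives.projectiveSpace n k).left)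
    (h : ¬ NoseHypHostedNestEquinodalDirectBTriplePrime₂ k n H ι) : ¬ NoseHypHostedNestEquinodalBTriplePrime₂ k n H ι :=
  fun h' => h (noseHypHostedNestEquinodalDirectBTriplePrime₂_of_equinodal₂ k n H ι h')

/-- … `¬ (ν4 ∨ ν3ᵈ blob) → ¬ blob₂`. [OURS · pure logic] -/
theorem not_noseHypHostedNestBTriplePrime₂_of_not_equinodalDirect₂ (k : Type) [Field k] [IsAlgClosed k] (n : ℕ)
    (H : AlgebraicGeometry.Scheme.{0}) (ι : H ⟶ (Literature.AlgebraicGeometry.Motives.projectiveSpace n k).left)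
    (h : ¬ NoseHypHostedNestEquinodalDirectBTriplePrime₂ k n H ι) : ¬ NoseHypHostedNestBTriplePrime₂ k n H ι :=
  not_noseHypHostedNestBTriplePrime₂_of_not_hostedNestEquinodal₂ k n H ι
    (not_noseHypHostedNestEquinodalBTriplePrime₂_of_not_equinodalDirect₂ k n H ι h)

/-- … `¬ (ν4 ∨ ν3ᵈ blob) → ¬ NoseHypPointsFirstBTriplePrime`. [OURS · pure logic] -/
theorem not_noseHypPointsFirstBTriplePrime_of_not_equinodalDirect₂ (k : Type) [Field k] [IsAlgClosed k] (n : ℕ)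
    (H : AlgebraicGeometry.Scheme.{0}) (ι : H ⟶ (Literature.AlgebraicGeometry.Motives.projectiveSpace n k).left)
    (h : ¬ NoseHypHostedNestEquinodalDirectBTriplePrime₂ k n H ι) : ¬ NoseHypPointsFirstBTriplePrime k n H ι :=
  not_noseHypPointsFirstBTriplePrime_of_not_hostedNestEquinodal₂ k n H ι
    (not_noseHypHostedNestEquinodalBTriplePrime₂_of_not_equinodalDirect₂ k n H ι h)

end Summit.ResolutionOfSingularities.ResolutionOfSingularities.Cruxes.EquisingularLiftNat.Sections

end
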